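/-
Copyright (c) 2026. All rights reserved.
Released under Apache 2.0 license as described in the file LICENSE.
-/
import Literature.AlgebraicGeometry.ComplexMultiplication.HyperellipticJacobianGenericCompositeLevel
import HarnessLib

/-!
# GGL 2024 Thm. 3.0 + Lemma 14 at the levels `m = 12M′`, `M′` odd, `5 ∤ M′` (`12 ∣ m`, `8 ∤ m`, `20 ∤ m`):
# `End⁰(J_m) ≅ Mat₃(ℚ(i)) × ∏_{d ∣ m odd, d ≠ 1} Mat₂(ℚ(ζ_d)) × ∏_{4 ∣ e ∣ m, e ∉ {4, 12}} Mat₂(ℚ(ζ_e − ζ_e⁻¹))`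

Layer `Literature/AlgebraicGeometry/ComplexMultiplication`, namespace `…ComplexMultiplication.HyperellipticJacobian`; the family-form assembly of
`HyperellipticJacobianGenericCompositeLevel` (F24) with the `ℚ(i)`-block `X_4 ⊕ X_{12} ∼ X_4³` of `HyperellipticJacobianLevelTwelveJacobian` (F15) in place
of `X_4`.  THEOREMS ONLY (no definition, no named fact, no `sorry`, no instance).

## The print

A. Gallese, H. Goodson, D. Lombardo, arXiv:2405.20394 [GalleseGoodsonLombardo2024] (held `paper:arxiv-2405.20394`, p0012, p0015): THM. 3.0
«`J_m ∼ ∏_{d ∣ m, d ≠ 1,2} X_d`», (4) «`X_{2d} ∼ X_d`» (`d` odd), (5) «`X_d ∼ Y_d²`» (`4 ∣ d ∉ {20, 24, 60}`; at `d = 12`: `Y_{12} ∼ X_4`, F14), the last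
statement, and §3.5 LEMMA 14 with the sentence following it.  When `12 ∣ m`, `8 ∤ m`, `20 ∤ m` (`m = 4M`, `M` odd, `3 ∣ M`, `5 ∤ M`) the divisors
`d ∉ {1, 2}` of `m` are: `4, 12` (the `ℚ(i)`-block `X_4 ⊕ X_{12} ∼ X_4³`, `End⁰ ≅ Mat₃(ℚ(i))`, F15); the pairs `{d, 2d}` over the odd divisors `d ≠ 1`;
and the `e = 4d′`, `d′ ∣ M`, `d′ ∉ {1, 3}` — non-exceptional, `≠ 12`, pairwise orthogonal `Y`-blocks — so
`End⁰(J_m) ≅ Mat₃(ℚ(ζ_4)) × ∏_{d ∣ M, d ≠ 1} Mat₂(ℚ(ζ_d)) × ∏_{e} Mat₂(ℚ(ζ_e − ζ_e⁻¹))`, of dimension `18 + 4 Σ_d φ(d) + 2 Σ_e φ(e)`, and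
`2 dim J_m = 6 + 2 Σ_d φ(d) + Σ_e φ(e)` (`m = 12`: `Mat₂(ℚ(ζ_3)) × Mat₃(ℚ(i))`, `26`, `g = 5`, F15; `m = 36`: `74`, `g = 17`; `m = 84`: `170`, `g = 41`).

## The carrier (family form)

`![A₄ ⊕ A₁₂, ⨁_i (A_i ⊕ A′_i), ⨁_j C_j]` over `Fin 3`: `A₄`, `A₁₂` realisations of the lower-half types of `ℚ(ζ_4)`, `ℚ(ζ_{12})`; for `i : Fin (k₁ + 1)`,
realisations `A_i` of `Φ_{d_i}` (`d_i ∣ M` odd, `d_i > 1`, distinct) and `A′_i` of `Φ_{2d_i}`; for `j : Fin k₂` (possibly `k₂ = 0`), realisations `C_j` of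
`Φ_{e_j}` (`4 ∣ e_j ≥ 8`, `e_j ∉ {12, 20, 24, 60}`, distinct).

## What is proved

`dim_pair_four_twelve` (`dim(A₄ ⊕ A₁₂) = 3`), **`hom_eq_zero_blocks_twelveTimesOdd`** (the three parts pairwise orthogonal),
**`nonempty_endAlgebra_algEquiv_twelveTimesOdd`** (`End⁰ ≃ₐ[ℚ] Mat₃(ℚ(ζ_4)) × ((∏_i Mat₂(ℚ(ζ_{d_i}))) × ∏_j Mat₂(ℚ(ζ_{e_j} − ζ_{e_j}⁻¹)))`),
**`finrank_endAlgebra_twelveTimesOdd`**.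

## Honest column ∕ NOT here

The curve; `24 ∣ m` (the exceptional block `Y_{24}`, F18) and `20 ∣ m` (F16 ∕ F20 ∕ F22); the closed forms of the sums.  `HC_CM` is not touched.

## References

* [GalleseGoodsonLombardo2024] arXiv:2405.20394 — §3 Thm. 3.0 ((4), (5), last statement), §3.5 Lemma 14 and the sentence following it.
* [MumfordAV1970] D. Mumford — §19 Thm. 3 Cor. 1–2, p. 174.
* [Shimura1998] G. Shimura — §5.1 Prop. 3, Prop. 6, §8.3 Prop. 28.
* [MilneCM2006] J. S. Milne — Ch. I §1 Prop. 1.18 (c), §3 Prop. 3.13.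

## Provenance

Cell `pub-hodgecm2` (COR-CM), KEPT Literature lane `lit-deligne-3` gen 52 (claim GGL24-TWELVE-TIMES-ODD; count-neutral, own lane).
-/

noncomputable section

open CategoryTheory CategoryTheory.Limits NumberField Module

namespace Literature.AlgebraicGeometry.ComplexMultiplication

open Literature.AlgebraicGeometry.Motives
open Literature.AlgebraicGeometry.HodgeTheory (complexBetti)
open Literature.NumberTheory.ComplexMultiplication

namespace HyperellipticJacobian

open Literature.AlgebraicGeometry.Pohlmann1968 Literature.AlgebraicGeometry.Pohlmann1968.Cyclotomic

section TwelveTimesOdd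

variable {K₄ : Type} [Field K₄] [NumberField K₄] [IsCyclotomicExtension {4} ℚ K₄] {Φ₄ : CMType K₄}
  {A₄ : AbelianVariety ℂ} {ι₄ : 𝓞 K₄ →+* End A₄} {θ₄ : K₄ →+* Module.End ℂ (complexBetti A₄.X 1)}
  {K₁₂ : Type} [Field K₁₂] [NumberField K₁₂] [IsCyclotomicExtension {12} ℚ K₁₂] {Φ₁₂ : CMType K₁₂}
  {A₁₂ : AbelianVariety ℂ} {ι₁₂ : 𝓞 K₁₂ →+* End A₁₂} {θ₁₂ : K₁₂ →+* Module.End ℂ (complexBetti A₁₂.X 1)}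
  {k₁ : ℕ} {lev₁ : Fin (k₁ + 1) → ℕ} [∀ i, NeZero (lev₁ i)] [∀ i, NeZero (2 * lev₁ i)]
  {K : Fin (k₁ + 1) → Type} [∀ i, Field (K i)] [∀ i, NumberField (K i)] [∀ i, IsCyclotomicExtension {lev₁ i} ℚ (K i)]
  {L : Fin (k₁ + 1) → Type} [∀ i, Field (L i)] [∀ i, NumberField (L i)] [∀ i, IsCyclotomicExtension {2 * lev₁ i} ℚ (L i)]
  {Φ : ∀ i, CMType (K i)} {ΦL : ∀ i, CMType (L i)}
  {A A' : Fin (k₁ + 1) → AbelianVariety ℂ} {ι : ∀ i, 𝓞 (K i) →+* End (A i)}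
  {θ : ∀ i, K i →+* Module.End ℂ (complexBetti (A i).X 1)} {ι' : ∀ i, 𝓞 (L i) →+* End (A' i)}
  {θ' : ∀ i, L i →+* Module.End ℂ (complexBetti (A' i).X 1)} {M : ℕ}
  {k₂ : ℕ} {lev₂ : Fin k₂ → ℕ} [∀ j, NeZero (lev₂ j)] {F : Fin k₂ → Type} [∀ j, Field (F j)] [∀ j, NumberField (F j)]
  [∀ j, IsCyclotomicExtension {lev₂ j} ℚ (F j)] {Ψ : ∀ j, CMType (F j)} {C : Fin k₂ → AbelianVariety ℂ}
  {ιC : ∀ j, 𝓞 (F j) →+* End (C j)} {θC : ∀ j, F j →+* Module.End ℂ (complexBetti (C j).X 1)}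

omit [∀ i, NeZero (lev₁ i)] [∀ i, NeZero (2 * lev₁ i)] in
/-- Divisors `d_i > 1` of an odd `M` are odd and at least `3`. [folklore] -/
private theorem odd_and_three_le'' (hodd : Odd M) (hdvd : ∀ i, lev₁ i ∣ M) (h1 : ∀ i, 1 < lev₁ i) (i : Fin (k₁ + 1)) :
    Odd (lev₁ i) ∧ 3 ≤ lev₁ i := by
  have ho : Odd (lev₁ i) := hodd.of_dvd_nat (hdvd i)
  refine ⟨ho, ?_⟩
  obtain ⟨r, hr⟩ := ho
  have := h1 i
  omega

omit [IsCyclotomicExtension {4} ℚ K₄] in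
/-- `[ℚ(ζ_4) : ℚ] = 2`. [folklore] -/
private theorem finrank_eq_two_four_h [IsCyclotomicExtension {4} ℚ K₄] : finrank ℚ K₄ = 2 := by
  rw [finrank_eq_totient 4 K₄]
  decide +kernel

/-- **`dim(X_4 ⊕ X_{12}) = 3`** (`dim X_4 = 1`, `dim X_{12} = φ(12)/2 = 2`). [cite: GalleseGoodsonLombardo2024, §3 Thm. 3.0 («dim X_d = φ(d)/2»)]
[cite: MilneCM2006, Ch. I §3 Prop. 3.13] -/
theorem dim_pair_four_twelve (hA₄ : IsCMTypeRealisation Φ₄ A₄ ι₄ θ₄) (hA₁₂ : IsCMTypeRealisation Φ₁₂ A₁₂ ι₁₂ θ₁₂) :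
    (⨁ fun l : Fin 2 => (![A₄, A₁₂] : Fin 2 → AbelianVariety ℂ) l).dim = 3 := by
  classical
  haveI : NeZero (12 : ℕ) := ⟨by norm_num⟩
  have hd₄ : A₄.dim = 1 := by
    have h : A₄.dim = finrank ℚ K₄ / 2 := Motives.schemeDim_eq_holds hA₄.1
    rw [finrank_eq_two_four_h (K₄ := K₄)] at h
    simpa using h
  have hd₁₂ : A₁₂.dim = 2 := by
    have h : A₁₂.dim = finrank ℚ K₁₂ / 2 := Motives.schemeDim_eq_holds hA₁₂.1
    rw [finrank_eq_totient 12 K₁₂, show Nat.totient 12 = 4 by decide +kernel] at h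
    simpa using h
  rw [AbelianVariety.dim_biproduct, Fin.sum_univ_two]
  simp only [Matrix.cons_val_zero, Matrix.cons_val_one]
  omega

/-- **The three parts `X_4 ⊕ X_{12}`, `⨁_i (X_{d_i} ⊕ X_{2d_i})`, `⨁_j X_{e_j}` of `J_m` (`12 ∣ m`, `8 ∤ m`, `20 ∤ m`) are pairwise orthogonal**:
`X_4, X_{12} ⟂ X_d, X_{2d}` (`d` odd: F12 `orthogonal_odd_four ∕ _twiceOdd_four ∕ _odd_fourDvd ∕ _twiceOdd_fourDvd` at level `12`), `X_4 ⟂ X_e` (`e ≠ 12`, F23),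
`X_{12} ⟂ X_e` (F23 `orthogonal_fourDvd_of_ne`), `X_d, X_{2d} ⟂ X_e` (F12) — assembled componentwise.
[cite: GalleseGoodsonLombardo2024, §3 Thm. 3.0 (last statement)] [cite: MilneCM2006, Ch. I §3 Prop. 3.13] -/
theorem hom_eq_zero_blocks_twelveTimesOdd (hodd : Odd M) (hdvd : ∀ i, lev₁ i ∣ M) (h1 : ∀ i, 1 < lev₁ i)
    (hΦ : ∀ i (σ : K i →+* ℂ), σ ∈ (Φ i).1 ↔ 2 * (expOf (lev₁ i) (K i) σ).val < lev₁ i)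
    (hΦL : ∀ i (σ : L i →+* ℂ), σ ∈ (ΦL i).1 ↔ 2 * (expOf (2 * lev₁ i) (L i) σ).val < 2 * lev₁ i)
    (hA : ∀ i, IsCMTypeRealisation (Φ i) (A i) (ι i) (θ i)) (hA' : ∀ i, IsCMTypeRealisation (ΦL i) (A' i) (ι' i) (θ' i))
    (hA₄ : IsCMTypeRealisation Φ₄ A₄ ι₄ θ₄)
    (hΦ₁₂ : ∀ σ : K₁₂ →+* ℂ, σ ∈ Φ₁₂.1 ↔ 2 * (expOf 12 K₁₂ σ).val < 12) (hA₁₂ : IsCMTypeRealisation Φ₁₂ A₁₂ ι₁₂ θ₁₂)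
    (h4 : ∀ j, 4 ∣ lev₂ j) (h8 : ∀ j, 8 ≤ lev₂ j) (h12 : ∀ j, lev₂ j ≠ 12) (h20 : ∀ j, lev₂ j ≠ 20) (h24 : ∀ j, lev₂ j ≠ 24)
    (h60 : ∀ j, lev₂ j ≠ 60) (hΨ : ∀ j (σ : F j →+* ℂ), σ ∈ (Ψ j).1 ↔ 2 * (expOf (lev₂ j) (F j) σ).val < lev₂ j)
    (hC : ∀ j, IsCMTypeRealisation (Ψ j) (C j) (ιC j) (θC j)) :
    ∀ a b : Fin 3, a ≠ b →
      ∀ f : (![⨁ fun l : Fin 2 => (![A₄, A₁₂] : Fin 2 → AbelianVariety ℂ) l,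
              ⨁ fun i => ⨁ fun l : Fin 2 => (![A i, A' i] : Fin 2 → AbelianVariety ℂ) l, ⨁ C] : Fin 3 → AbelianVariety ℂ) a ⟶
        (![⨁ fun l : Fin 2 => (![A₄, A₁₂] : Fin 2 → AbelianVariety ℂ) l,
           ⨁ fun i => ⨁ fun l : Fin 2 => (![A i, A' i] : Fin 2 → AbelianVariety ℂ) l, ⨁ C] : Fin 3 → AbelianVariety ℂ) b, f = 0 := by
  classical
  haveI : NeZero (12 : ℕ) := ⟨by norm_num⟩
  have ho : ∀ i, Odd (lev₁ i) ∧ 3 ≤ lev₁ i := odd_and_three_le'' hodd hdvd h1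
  have h4₁₂ : 4 ∣ 12 := by norm_num
  have h8₁₂ : 8 ≤ 12 := by norm_num
  have h20₁₂ : (12 : ℕ) ≠ 20 := by norm_num
  have h24₁₂ : (12 : ℕ) ≠ 24 := by norm_num
  have h60₁₂ : (12 : ℕ) ≠ 60 := by norm_num
  -- the elementary relations
  have o4A : ∀ i, (∀ u : A i ⟶ A₄, u = 0) ∧ (∀ v : A₄ ⟶ A i, v = 0) := fun i =>
    let h := orthogonal_odd_four (Φ' := Φ₄) (ho i).1 (ho i).2 (hΦ i) (hA i) hA₄
    ⟨h.1, h.2.1⟩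
  have o4A' : ∀ i, (∀ u : A' i ⟶ A₄, u = 0) ∧ (∀ v : A₄ ⟶ A' i, v = 0) := fun i =>
    let h := orthogonal_twiceOdd_four (Φ' := Φ₄) (ho i).1 (ho i).2 (hΦL i) (hA' i) hA₄
    ⟨h.1, h.2.1⟩
  have o12A : ∀ i, (∀ u : A i ⟶ A₁₂, u = 0) ∧ (∀ v : A₁₂ ⟶ A i, v = 0) := fun i =>
    let h := orthogonal_odd_fourDvd (ho i).1 (ho i).2 (hΦ i) (hA i) h4₁₂ h8₁₂ h20₁₂ h24₁₂ h60₁₂ hΦ₁₂ hA₁₂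
    ⟨h.1, h.2.1⟩
  have o12A' : ∀ i, (∀ u : A' i ⟶ A₁₂, u = 0) ∧ (∀ v : A₁₂ ⟶ A' i, v = 0) := fun i =>
    let h := orthogonal_twiceOdd_fourDvd (ho i).1 (ho i).2 (hΦL i) (hA' i) h4₁₂ h8₁₂ h20₁₂ h24₁₂ h60₁₂ hΦ₁₂ hA₁₂
    ⟨h.1, h.2.1⟩
  have o4C : ∀ j, (∀ u : A₄ ⟶ C j, u = 0) ∧ (∀ v : C j ⟶ A₄, v = 0) := fun j =>
    let h := orthogonal_four_fourDvd_of_ne_twelve hA₄ (h4 j) (h8 j) (h12 j) (h20 j) (h24 j) (h60 j) (hΨ j) (hC j)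
    ⟨h.1, h.2.1⟩
  have o12C : ∀ j, (∀ u : A₁₂ ⟶ C j, u = 0) ∧ (∀ v : C j ⟶ A₁₂, v = 0) := fun j =>
    let h := orthogonal_fourDvd_of_ne h4₁₂ h8₁₂ h20₁₂ h24₁₂ h60₁₂ hΦ₁₂ hA₁₂ (h4 j) (h8 j) (h20 j) (h24 j) (h60 j) (hΨ j) (hC j)
      (fun h => h12 j h.symm)
    ⟨h.1, h.2.1⟩
  have oAC : ∀ i j, (∀ u : A i ⟶ C j, u = 0) ∧ (∀ v : C j ⟶ A i, v = 0) := fun i j =>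
    let h := orthogonal_odd_fourDvd (ho i).1 (ho i).2 (hΦ i) (hA i) (h4 j) (h8 j) (h20 j) (h24 j) (h60 j) (hΨ j) (hC j)
    ⟨h.1, h.2.1⟩
  have oA'C : ∀ i j, (∀ u : A' i ⟶ C j, u = 0) ∧ (∀ v : C j ⟶ A' i, v = 0) := fun i j =>
    let h := orthogonal_twiceOdd_fourDvd (ho i).1 (ho i).2 (hΦL i) (hA' i) (h4 j) (h8 j) (h20 j) (h24 j) (h60 j) (hΨ j) (hC j)
    ⟨h.1, h.2.1⟩
  -- block-level relations
  have b01 : (∀ u : (⨁ fun l : Fin 2 => (![A₄, A₁₂] : Fin 2 → AbelianVariety ℂ) l) ⟶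
        ⨁ fun i => ⨁ fun l : Fin 2 => (![A i, A' i] : Fin 2 → AbelianVariety ℂ) l, u = 0) ∧
      (∀ v : (⨁ fun i => ⨁ fun l : Fin 2 => (![A i, A' i] : Fin 2 → AbelianVariety ℂ) l) ⟶
        ⨁ fun l : Fin 2 => (![A₄, A₁₂] : Fin 2 → AbelianVariety ℂ) l, v = 0) :=
    ⟨fun u => hom_to_biproduct_eq_zero
        (fun i w => hom_pair_pair_eq_zero (o4A i).2 (o4A' i).2 (o12A i).2 (o12A' i).2 w) u,
      fun v => hom_from_biproduct_eq_zero
        (fun i w => hom_pair_pair_eq_zero (o4A i).1 (o12A i).1 (o4A' i).1 (o12A' i).1 w) v⟩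
  have b02 : (∀ u : (⨁ fun l : Fin 2 => (![A₄, A₁₂] : Fin 2 → AbelianVariety ℂ) l) ⟶ ⨁ C, u = 0) ∧
      (∀ v : (⨁ C) ⟶ ⨁ fun l : Fin 2 => (![A₄, A₁₂] : Fin 2 → AbelianVariety ℂ) l, v = 0) :=
    ⟨fun u => hom_to_biproduct_eq_zero (fun j w => hom_from_pair_eq_zero (o4C j).1 (o12C j).1 w) u,
      fun v => hom_from_biproduct_eq_zero (fun j w => hom_to_pair_eq_zero (o4C j).2 (o12C j).2 w) v⟩
  have b12 : (∀ u : (⨁ fun i => ⨁ fun l : Fin 2 => (![A i, A' i] : Fin 2 → AbelianVariety ℂ) l) ⟶ ⨁ C, u = 0) ∧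
      (∀ v : (⨁ C) ⟶ ⨁ fun i => ⨁ fun l : Fin 2 => (![A i, A' i] : Fin 2 → AbelianVariety ℂ) l, v = 0) :=
    ⟨fun u => AbelianVariety.hom_biproduct_eq_zero (fun i j w => hom_from_pair_eq_zero (oAC i j).1 (oA'C i j).1 w) u,
      fun v => AbelianVariety.hom_biproduct_eq_zero (fun j i w => hom_to_pair_eq_zero (oAC i j).2 (oA'C i j).2 w) v⟩
  -- assemble
  have g1 := hom_eq_zero_vecCons (X := ⨁ fun i => ⨁ fun l : Fin 2 => (![A i, A' i] : Fin 2 → AbelianVariety ℂ) l)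
    (F := (![⨁ C] : Fin 1 → AbelianVariety ℂ)) (Fin.cons b12 finZeroElim) hom_eq_zero_of_fin_one
  exact hom_eq_zero_vecCons (X := ⨁ fun l : Fin 2 => (![A₄, A₁₂] : Fin 2 → AbelianVariety ℂ) l)
    (F := (![⨁ fun i => ⨁ fun l : Fin 2 => (![A i, A' i] : Fin 2 → AbelianVariety ℂ) l, ⨁ C] : Fin 2 → AbelianVariety ℂ))
    (Fin.cons b01 (Fin.cons b02 finZeroElim)) g1

/-- The product of three algebras indexed by `Fin 3`. [folklore] -/
private theorem nonempty_pi_fin_three_algEquiv_prod_h (T : Fin 3 → Type) [∀ i, Ring (T i)] [∀ i, Algebra ℚ (T i)] :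
    Nonempty ((∀ i, T i) ≃ₐ[ℚ] T 0 × (T 1 × T 2)) := by
  refine ⟨AlgEquiv.ofBijective
    ((Pi.evalAlgHom ℚ T 0).prod ((Pi.evalAlgHom ℚ T 1).prod (Pi.evalAlgHom ℚ T 2))) ⟨fun f g h => ?_, fun x => ?_⟩⟩
  · simp only [AlgHom.prod_apply, Pi.evalAlgHom_apply, Prod.mk.injEq] at h
    funext i
    match i with
    | ⟨0, _⟩ => exact h.1
    | ⟨1, _⟩ => exact h.2.1
    | ⟨2, _⟩ => exact h.2.2
  · exact ⟨Fin.cons x.1 (Fin.cons x.2.1 (Fin.cons x.2.2 finZeroElim)), rfl⟩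

/-- **GGL THM. 3.0 + LEMMA 14 at the levels `m = 12M′`, `M′` odd, `5 ∤ M′` (family form):
`End⁰(J_m) ≃ₐ[ℚ] Mat₃(ℚ(ζ_4)) × ((∏_i Mat₂(ℚ(ζ_{d_i}))) × (∏_j Mat₂(ℚ(ζ_{e_j} − ζ_{e_j}⁻¹))))`** on the carrier `![A₄ ⊕ A₁₂, ⨁_i (A_i ⊕ A′_i), ⨁_j C_j]` —
the three parts are pairwise orthogonal, `End⁰(A₄ ⊕ A₁₂) ≅ Mat₃(ℚ(ζ_4))` (F15: `X_4 ⊕ X_{12} ∼ X_4³`), `End⁰(⨁_i (A_i ⊕ A′_i)) ≅ ∏_i Mat₂(ℚ(ζ_{d_i}))` (F11),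
`End⁰(⨁_j C_j) ≅ ∏_j Mat₂(ℚ(ζ_{e_j} − ζ_{e_j}⁻¹))` (F24 §1).
[cite: GalleseGoodsonLombardo2024, §3.5 Lemma 14 and the sentence following it; §3 Thm. 3.0 (4), (5), last statement]
[cite: MumfordAV1970, §19 Cor. 2 of Thm. 3 and p. 174] [cite: Shimura1998, §5.1 Prop. 3 (proof) and Prop. 6] -/
theorem nonempty_endAlgebra_algEquiv_twelveTimesOdd [NeZero M] (hodd : Odd M) (hdvd : ∀ i, lev₁ i ∣ M) (hinj₁ : Function.Injective lev₁)
    (h1 : ∀ i, 1 < lev₁ i) (hΦ : ∀ i (σ : K i →+* ℂ), σ ∈ (Φ i).1 ↔ 2 * (expOf (lev₁ i) (K i) σ).val < lev₁ i)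
    (hΦL : ∀ i (σ : L i →+* ℂ), σ ∈ (ΦL i).1 ↔ 2 * (expOf (2 * lev₁ i) (L i) σ).val < 2 * lev₁ i)
    (hA : ∀ i, IsCMTypeRealisation (Φ i) (A i) (ι i) (θ i)) (hA' : ∀ i, IsCMTypeRealisation (ΦL i) (A' i) (ι' i) (θ' i))
    (hΦ₄ : ∀ σ : K₄ →+* ℂ, σ ∈ Φ₄.1 ↔ 2 * (expOf 4 K₄ σ).val < 4) (hA₄ : IsCMTypeRealisation Φ₄ A₄ ι₄ θ₄)
    (hΦ₁₂ : ∀ σ : K₁₂ →+* ℂ, σ ∈ Φ₁₂.1 ↔ 2 * (expOf 12 K₁₂ σ).val < 12) (hA₁₂ : IsCMTypeRealisation Φ₁₂ A₁₂ ι₁₂ θ₁₂)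
    (h4 : ∀ j, 4 ∣ lev₂ j) (h8 : ∀ j, 8 ≤ lev₂ j) (h12 : ∀ j, lev₂ j ≠ 12) (h20 : ∀ j, lev₂ j ≠ 20) (h24 : ∀ j, lev₂ j ≠ 24)
    (h60 : ∀ j, lev₂ j ≠ 60) (hinj₂ : Function.Injective lev₂)
    (hΨ : ∀ j (σ : F j →+* ℂ), σ ∈ (Ψ j).1 ↔ 2 * (expOf (lev₂ j) (F j) σ).val < lev₂ j)
    (hC : ∀ j, IsCMTypeRealisation (Ψ j) (C j) (ιC j) (θC j)) :
    Nonempty ((⨁ fun a : Fin 3 =>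
        (![⨁ fun l : Fin 2 => (![A₄, A₁₂] : Fin 2 → AbelianVariety ℂ) l,
           ⨁ fun i => ⨁ fun l : Fin 2 => (![A i, A' i] : Fin 2 → AbelianVariety ℂ) l, ⨁ C] : Fin 3 → AbelianVariety ℂ) a).endAlgebra ≃ₐ[ℚ]
      Matrix (Fin 3) (Fin 3) K₄ × ((∀ i, Matrix (Fin 2) (Fin 2) (K i)) ×
        (∀ j, Matrix (Fin 2) (Fin 2) (IntermediateField.adjoin ℚ {zetaOf (lev₂ j) (F j) - (zetaOf (lev₂ j) (F j))⁻¹})))) := by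
  classical
  obtain ⟨E, -⟩ := AbelianVariety.nonempty_algEquiv_endAlgebra_biproduct_pi
    (A := fun a : Fin 3 => (![⨁ fun l : Fin 2 => (![A₄, A₁₂] : Fin 2 → AbelianVariety ℂ) l,
      ⨁ fun i => ⨁ fun l : Fin 2 => (![A i, A' i] : Fin 2 → AbelianVariety ℂ) l, ⨁ C] : Fin 3 → AbelianVariety ℂ) a)
    (hom_eq_zero_blocks_twelveTimesOdd hodd hdvd h1 hΦ hΦL hA hA' hA₄ hΦ₁₂ hA₁₂ h4 h8 h12 h20 h24 h60 hΨ hC)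
  obtain ⟨P⟩ := nonempty_pi_fin_three_algEquiv_prod_h
    (fun a : Fin 3 => ((![⨁ fun l : Fin 2 => (![A₄, A₁₂] : Fin 2 → AbelianVariety ℂ) l,
      ⨁ fun i => ⨁ fun l : Fin 2 => (![A i, A' i] : Fin 2 → AbelianVariety ℂ) l, ⨁ C] : Fin 3 → AbelianVariety ℂ) a).endAlgebra)
  obtain ⟨e₀⟩ := nonempty_endAlgebra_four_twelve_algEquiv_matrix hΦ₄ hA₄ hΦ₁₂ hA₁₂
  obtain ⟨e₁⟩ := nonempty_endAlgebra_algEquiv_pi_matrix_twiceOdd hodd hdvd hinj₁ h1 hΦ hΦL hA hA'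
  obtain ⟨e₂⟩ := nonempty_endAlgebra_biproduct_algEquiv_pi_fourDvd h4 h8 h20 h24 h60 hinj₂ hΨ hC
  exact ⟨(E.trans P).trans (AlgEquiv.prodCongr e₀ (AlgEquiv.prodCongr e₁ e₂))⟩

/-- **Dimension count at the levels `m = 12M′`, `M′` odd, `5 ∤ M′`: `dim_ℚ End⁰(J) = 18 + 4 Σ_i φ(d_i) + 2 Σ_j φ(e_j)` and
`2 dim J = 6 + 2 Σ_i φ(d_i) + Σ_j φ(e_j)`** (`m = 36`: `74`, `g = 17`; `m = 84`: `170`, `g = 41`).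
[cite: GalleseGoodsonLombardo2024, §3 Thm. 3.0 («dim X_d = φ(d)/2») and §3.5 Lemma 14] [cite: MumfordAV1970, §19 Cor. 2 of Thm. 3] -/
theorem finrank_endAlgebra_twelveTimesOdd [NeZero M] (hodd : Odd M) (hdvd : ∀ i, lev₁ i ∣ M) (hinj₁ : Function.Injective lev₁)
    (h1 : ∀ i, 1 < lev₁ i) (hΦ : ∀ i (σ : K i →+* ℂ), σ ∈ (Φ i).1 ↔ 2 * (expOf (lev₁ i) (K i) σ).val < lev₁ i)
    (hΦL : ∀ i (σ : L i →+* ℂ), σ ∈ (ΦL i).1 ↔ 2 * (expOf (2 * lev₁ i) (L i) σ).val < 2 * lev₁ i)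
    (hA : ∀ i, IsCMTypeRealisation (Φ i) (A i) (ι i) (θ i)) (hA' : ∀ i, IsCMTypeRealisation (ΦL i) (A' i) (ι' i) (θ' i))
    (hΦ₄ : ∀ σ : K₄ →+* ℂ, σ ∈ Φ₄.1 ↔ 2 * (expOf 4 K₄ σ).val < 4) (hA₄ : IsCMTypeRealisation Φ₄ A₄ ι₄ θ₄)
    (hΦ₁₂ : ∀ σ : K₁₂ →+* ℂ, σ ∈ Φ₁₂.1 ↔ 2 * (expOf 12 K₁₂ σ).val < 12) (hA₁₂ : IsCMTypeRealisation Φ₁₂ A₁₂ ι₁₂ θ₁₂)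
    (h4 : ∀ j, 4 ∣ lev₂ j) (h8 : ∀ j, 8 ≤ lev₂ j) (h12 : ∀ j, lev₂ j ≠ 12) (h20 : ∀ j, lev₂ j ≠ 20) (h24 : ∀ j, lev₂ j ≠ 24)
    (h60 : ∀ j, lev₂ j ≠ 60) (hinj₂ : Function.Injective lev₂)
    (hΨ : ∀ j (σ : F j →+* ℂ), σ ∈ (Ψ j).1 ↔ 2 * (expOf (lev₂ j) (F j) σ).val < lev₂ j)
    (hC : ∀ j, IsCMTypeRealisation (Ψ j) (C j) (ιC j) (θC j)) :
    finrank ℚ (⨁ fun a : Fin 3 =>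
        (![⨁ fun l : Fin 2 => (![A₄, A₁₂] : Fin 2 → AbelianVariety ℂ) l,
           ⨁ fun i => ⨁ fun l : Fin 2 => (![A i, A' i] : Fin 2 → AbelianVariety ℂ) l, ⨁ C] : Fin 3 → AbelianVariety ℂ) a).endAlgebra =
      18 + 4 * ∑ i, Nat.totient (lev₁ i) + 2 * ∑ j, Nat.totient (lev₂ j) ∧
    2 * (⨁ fun a : Fin 3 =>
        (![⨁ fun l : Fin 2 => (![A₄, A₁₂] : Fin 2 → AbelianVariety ℂ) l,
           ⨁ fun i => ⨁ fun l : Fin 2 => (![A i, A' i] : Fin 2 → AbelianVariety ℂ) l, ⨁ C] : Fin 3 → AbelianVariety ℂ) a).dim =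
      6 + 2 * ∑ i, Nat.totient (lev₁ i) + ∑ j, Nat.totient (lev₂ j) := by
  classical
  have ho : ∀ i, Odd (lev₁ i) ∧ 3 ≤ lev₁ i := odd_and_three_le'' hodd hdvd h1
  obtain ⟨hfrC, hdimC⟩ := finrank_endAlgebra_biproduct_fourDvd h4 h8 h20 h24 h60 hinj₂ hΨ hC
  have hK : ∀ i, finrank ℚ (K i) = Nat.totient (lev₁ i) := fun i => finrank_eq_totient (lev₁ i) (K i)
  refine ⟨?_, ?_⟩
  · obtain ⟨e⟩ := nonempty_endAlgebra_algEquiv_twelveTimesOdd hodd hdvd hinj₁ h1 hΦ hΦL hA hA' hΦ₄ hA₄ hΦ₁₂ hA₁₂ h4 h8 h12 h20 h24 h60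
      hinj₂ hΨ hC
    obtain ⟨e₂⟩ := nonempty_endAlgebra_biproduct_algEquiv_pi_fourDvd h4 h8 h20 h24 h60 hinj₂ hΨ hC
    haveI : ∀ j, FiniteDimensional ℚ (IntermediateField.adjoin ℚ {zetaOf (lev₂ j) (F j) - (zetaOf (lev₂ j) (F j))⁻¹}) := fun j =>
      IntermediateField.finiteDimensional_left _
    haveI : ∀ j, Module.Finite ℚ (Matrix (Fin 2) (Fin 2)
        (IntermediateField.adjoin ℚ {zetaOf (lev₂ j) (F j) - (zetaOf (lev₂ j) (F j))⁻¹})) := fun j => Module.Finite.matrix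
    haveI : ∀ j, Module.Free ℚ (Matrix (Fin 2) (Fin 2)
        (IntermediateField.adjoin ℚ {zetaOf (lev₂ j) (F j) - (zetaOf (lev₂ j) (F j))⁻¹})) := fun j => inferInstance
    haveI : ∀ i, Module.Finite ℚ (Matrix (Fin 2) (Fin 2) (K i)) := fun i => Module.Finite.matrix
    haveI : ∀ i, Module.Free ℚ (Matrix (Fin 2) (Fin 2) (K i)) := fun i => inferInstance
    haveI : Module.Finite ℚ (∀ j, Matrix (Fin 2) (Fin 2)
        (IntermediateField.adjoin ℚ {zetaOf (lev₂ j) (F j) - (zetaOf (lev₂ j) (F j))⁻¹})) := inferInstance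
    haveI : Module.Free ℚ (∀ j, Matrix (Fin 2) (Fin 2)
        (IntermediateField.adjoin ℚ {zetaOf (lev₂ j) (F j) - (zetaOf (lev₂ j) (F j))⁻¹})) := inferInstance
    haveI : Module.Finite ℚ (∀ i, Matrix (Fin 2) (Fin 2) (K i)) := inferInstance
    haveI : Module.Free ℚ (∀ i, Matrix (Fin 2) (Fin 2) (K i)) := inferInstance
    haveI : Module.Finite ℚ ((∀ i, Matrix (Fin 2) (Fin 2) (K i)) × (∀ j, Matrix (Fin 2) (Fin 2)
        (IntermediateField.adjoin ℚ {zetaOf (lev₂ j) (F j) - (zetaOf (lev₂ j) (F j))⁻¹}))) := inferInstance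
    haveI : Module.Free ℚ ((∀ i, Matrix (Fin 2) (Fin 2) (K i)) × (∀ j, Matrix (Fin 2) (Fin 2)
        (IntermediateField.adjoin ℚ {zetaOf (lev₂ j) (F j) - (zetaOf (lev₂ j) (F j))⁻¹}))) := inferInstance
    haveI : Module.Finite ℚ (Matrix (Fin 3) (Fin 3) K₄) := Module.Finite.matrix
    haveI : Module.Free ℚ (Matrix (Fin 3) (Fin 3) K₄) := inferInstance
    have hmid : finrank ℚ (∀ i, Matrix (Fin 2) (Fin 2) (K i)) = 4 * ∑ i, Nat.totient (lev₁ i) := by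
      rw [Module.finrank_pi_fintype, Finset.mul_sum]
      refine Finset.sum_congr rfl fun i _ => ?_
      rw [Module.finrank_matrix, Fintype.card_fin, hK i]
    have hlast : finrank ℚ (∀ j, Matrix (Fin 2) (Fin 2)
        (IntermediateField.adjoin ℚ {zetaOf (lev₂ j) (F j) - (zetaOf (lev₂ j) (F j))⁻¹})) = 2 * ∑ j, Nat.totient (lev₂ j) := by
      rw [← e₂.toLinearEquiv.finrank_eq, hfrC]
    have hfirst : finrank ℚ (Matrix (Fin 3) (Fin 3) K₄) = 18 := by
      rw [Module.finrank_matrix, Fintype.card_fin, finrank_eq_two_four_h (K₄ := K₄)]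
    rw [e.toLinearEquiv.finrank_eq, Module.finrank_prod, Module.finrank_prod, hfirst, hmid, hlast, Nat.add_assoc]
  · have hpair : ∀ i, (⨁ fun l : Fin 2 => (![A i, A' i] : Fin 2 → AbelianVariety ℂ) l).dim = Nat.totient (lev₁ i) := fun i =>
      dim_pair_odd_twiceOdd (ho i).1 (ho i).2 (hΦ i) (hA i) (hΦL i) (hA' i)
    rw [AbelianVariety.dim_biproduct, Fin.sum_univ_three]
    show 2 * ((⨁ fun l : Fin 2 => (![A₄, A₁₂] : Fin 2 → AbelianVariety ℂ) l).dim +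
        (⨁ fun i => ⨁ fun l : Fin 2 => (![A i, A' i] : Fin 2 → AbelianVariety ℂ) l).dim + (⨁ C).dim) =
      6 + 2 * ∑ i, Nat.totient (lev₁ i) + ∑ j, Nat.totient (lev₂ j)
    rw [AbelianVariety.dim_biproduct (fun i => ⨁ fun l : Fin 2 => (![A i, A' i] : Fin 2 → AbelianVariety ℂ) l),
      Finset.sum_congr rfl fun i _ => hpair i, dim_pair_four_twelve hA₄ hA₁₂]
    omega

end TwelveTimesOdd

end HyperellipticJacobian

end Literature.AlgebraicGeometry.ComplexMultiplication

end
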